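import Mathlib.RingTheory.PowerSeries.Substitution
import Mathlib.RingTheory.PowerSeries.Expand
import Mathlib.RingTheory.PowerSeries.Derivative
import Mathlib.RingTheory.PowerSeries.Trunc
import Mathlib.RingTheory.PowerSeries.Order
import Mathlib.RingTheory.PowerSeries.NoZeroDivisors
import Mathlib.Algebra.Polynomial.Taylor
import Mathlib.Algebra.CharP.Frobenius
import Mathlib.Algebra.CharP.Quotient
import Mathlib.RingTheory.Ideal.Quotient.Basic
import Mathlib.NumberTheory.Padics.RingHoms
import Mathlib.RingTheory.WittVector.Identities
import Mathlib.RingTheory.WittVector.Domain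
import Mathlib.FieldTheory.Perfect
import Literature.NumberTheory.EllipticCurves.DivisionPolynomialFormalMulProofs
import Literature.NumberTheory.EllipticCurves.FormalGroupHasseInvariantProofs
import Literature.RingTheory.FormalGroups.FunctionalEquationIntegrality
import Literature.NumberTheory.EllipticCurves.FormalGroupMultiplicationUniversalProofs
import Literature.NumberTheory.EllipticCurves.FormalGroupLogHomProofs
import Literature.RingTheory.FormalGroups.HondaTypeTransport
import Literature.NumberTheory.EllipticCurves.FormalMulTwoSecondCoeffProofs
import Mathlib.RingTheory.WittVector.FrobeniusFractionField
import Mathlib.RingTheory.WittVector.Compare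
import Mathlib.FieldTheory.Finite.Basic
import Literature.NumberTheory.EllipticCurves.FormalLogExpBaseChangeProofs
import Summits.BirchSwinnertonDyer.BirchSwinnertonDyer.Theorems.EisensteinDepletionAtTwoStarGO2KEtaKernelB
import HarnessLib

/-!
# THEOREM K (the 2-adic Kummer class law for `z²(x(z) − x₀)`), kernel formalisation — KEtaSqDescentExp
(crux `StarGO2Sigma`, stmt-BirchSwinnertonDyer-27046; line kummer, research stub `stub_discrepancyCover`)

Planner bsd-rank2-p2 GEN 36–37's K-UNIV / K-ETA kernel files (HOME/p2/g37/lean, memo K-UNIV.md; monolith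
`KummerTheoremK_full.lean`, lean rc 0, 0 sorries), landed by the lead star-p1 GEN 12 in ≤ 400-line parts, verbatim except for
file packaging.  This part: the `[2]`-descent square identity `sq_descent_two'` with its mod-2 shape (RHO-g), and the comparison-function side `exp(c·log)`: `F∘[2] = F²`, `F′ = cωF`, descent along an injective map, `hlog` (SQ-F/RHO-F).
Nothing here reads `r_an`; `StarGO2Sigma` / E1M / BSD are NOT proved by this file.
-/

set_option linter.dupNamespace false
set_option linter.unusedSectionVars false
set_option autoImplicit false

noncomputable section

/-!
# The `[2]`-descent square identity: `x − x₀` becomes a square after substituting `[2]`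
(planner p2 GEN 37, cell bsd-rank2; hypothesis `hsqg` of `KummerKernelCore.kummerClass_transfer`;
memo `K-UNIV.md` §2 (SQ-g))

For a Weierstrass equation `W` over a commutative ring `R` in which `2` is a non-zero-divisor, a root
`x₀ ∈ R` of the `2`-division polynomial `ΨSq₂ = 4x³ + b₂x² + 2b₄x + b₆` (so `(x₀, y₀)` is a rational
`2`-torsion point) such that `c₀ := 4x₀² + b₂x₀ + b₄` is even, `c₀ = 2B`, and
`u = z²x(z)` (`formalXMulSq`), `Ỹ = z³(2y + a₁x + a₃)` (`formalYTilde`), `[2]` (`formalMul 2`):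

  `(Ỹ·z)² · (u∘[2] − x₀·[2]²) = ((u² − 2x₀z²u − Bz⁴)·[2])²`          (`sq_descent_two`)

i.e. `z² · (x − x₀)∘[2] = (square)/(Ỹz)²`: the function `x − x₀` pulled back along multiplication by
`2` is the square of `(x² − 2x₀x − B)/ψ₂` — the formal-group shadow of `x∘[2] − x₀ = (g₂/ψ₂)²` for the
`2`-isogenous decomposition.  Proof: the tree's division-polynomial identity
`WeierstrassCurve.sum_ΨSq_mul_formalXMulSq_subst_formalMul` at `n = 2` (`Ỹ²z²·u([2]) = z⁸Φ₂(x)·[2]²`),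
`Ỹ² = 4u³ + b₂z²u² + 2b₄z⁴u + b₆z⁶` (`formalYTilde_sq_eq`) and the ring identity
`4(Φ₂ − x₀ΨSq₂)(x) = (2x² − 4x₀x − c₀)² − (8x + 4x₀ + b₂)·ΨSq₂(x₀)` (which uses `4b₈ = b₂b₆ − b₄²`).
Over `ℤ₂` with `a₁` odd the parity condition is automatic (`c₀ ≡ a₁(x₀ + a₃)`, `ΨSq₂(x₀) ≡ (x₀ + a₃)²
(mod 2)`).  BSD is not proved here; nothing reads `r_an`.
-/



open PowerSeries

namespace Summit.BirchSwinnertonDyer.BirchSwinnertonDyer.Theorems.DepletionAtTwo.KEta.SqDescent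

variable {R : Type*} [CommRing R] (W : WeierstrassCurve R)

/-- The homogenised ring identity behind the `2`-descent:
`4(z⁸Φ₂(x) − x₀z²·z⁶ΨSq₂(x)) = (2u² − 4x₀z²u − c₀z⁴)² − (8u + 4x₀z² + b₂z²)z⁶·ΨSq₂(x₀)`,
`u = z²x`, `c₀ = 4x₀² + b₂x₀ + b₄`, given `4b₈ = b₂b₆ − b₄²`. [folklore] -/
theorem four_mul_Φ_two_sub_identity {S : Type*} [CommRing S] (u T x₀ b₂ b₄ b₆ b₈ : S)
    (hb : 4 * b₈ = b₂ * b₆ - b₄ ^ 2) :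
    4 * ((u ^ 4 - b₄ * T ^ 4 * u ^ 2 - 2 * b₆ * T ^ 6 * u - b₈ * T ^ 8)
        - x₀ * T ^ 2 * (4 * u ^ 3 + b₂ * T ^ 2 * u ^ 2 + 2 * b₄ * T ^ 4 * u + b₆ * T ^ 6)) =
      (2 * u ^ 2 - 4 * x₀ * T ^ 2 * u - (4 * x₀ ^ 2 + b₂ * x₀ + b₄) * T ^ 4) ^ 2
        - (8 * u + 4 * x₀ * T ^ 2 + b₂ * T ^ 2) * T ^ 6
          * (4 * x₀ ^ 3 + b₂ * x₀ ^ 2 + 2 * b₄ * x₀ + b₆) := by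
  linear_combination (-(T ^ 8)) * hb

/-- `2·f = 0 ⇒ f = 0` in `R⟦X⟧` from the same property of `R`. [folklore] -/
theorem eq_zero_of_two_mul_eq_zero' (h2 : ∀ a : R, 2 * a = 0 → a = 0) {f : R⟦X⟧} (h : 2 * f = 0) :
    f = 0 := by
  ext n
  have hn := congrArg (coeff n) h
  rw [show (2 : R⟦X⟧) = C (2 : R) from (map_ofNat C 2).symm, coeff_C_mul, map_zero] at hn
  rw [map_zero]
  exact h2 _ hn

/-- `4·f = 4·g ⇒ f = g` in `R⟦X⟧` when `2` is a non-zero-divisor of `R`. [folklore] -/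
theorem eq_of_four_mul_eq (h2 : ∀ a : R, 2 * a = 0 → a = 0) {f g : R⟦X⟧} (h : 4 * f = 4 * g) :
    f = g := by
  have h' : 2 * (2 * (f - g)) = 0 := by linear_combination h
  exact sub_eq_zero.mp (eq_zero_of_two_mul_eq_zero' h2 (eq_zero_of_two_mul_eq_zero' h2 h'))

/-- The left sum of the tree's identity (∗) at `n = 2` is `Ỹ²`. [folklore] -/
theorem sum_ΨSq_two_eq :
    (∑ i ∈ Finset.range (2 ^ 2),
        PowerSeries.C ((W.ΨSq 2).coeff i) * W.formalXMulSq ^ i * PowerSeries.X ^ (2 * (2 ^ 2 - 1 - i))) =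
      W.formalYTilde ^ 2 := by
  rw [W.formalYTilde_sq_eq]
  simp only [show (2 : ℕ) ^ 2 = 4 from rfl, Finset.sum_range_succ, Finset.sum_range_zero, zero_add,
    WeierstrassCurve.ΨSq_two, WeierstrassCurve.Ψ₂Sq, Polynomial.coeff_add, Polynomial.coeff_C_mul,
    Polynomial.coeff_X_pow, Polynomial.coeff_X, Polynomial.coeff_C]
  norm_num
  simp only [map_ofNat]
  ring

/-- The right sum of the tree's identity (∗) at `n = 2` is `z⁸Φ₂(x) = u⁴ − b₄z⁴u² − 2b₆z⁶u − b₈z⁸`.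
[folklore] -/
theorem sum_Φ_two_eq :
    (∑ i ∈ Finset.range (2 ^ 2 + 1),
        PowerSeries.C ((W.Φ 2).coeff i) * W.formalXMulSq ^ i * PowerSeries.X ^ (2 * (2 ^ 2 - i))) =
      W.formalXMulSq ^ 4 - C W.b₄ * X ^ 4 * W.formalXMulSq ^ 2 - 2 * C W.b₆ * X ^ 6 * W.formalXMulSq
        - C W.b₈ * X ^ 8 := by
  simp only [show (2 : ℕ) ^ 2 = 4 from rfl, Finset.sum_range_succ, Finset.sum_range_zero, zero_add,
    WeierstrassCurve.Φ_two, Polynomial.coeff_sub, Polynomial.coeff_C_mul,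
    Polynomial.coeff_X_pow, Polynomial.coeff_X, Polynomial.coeff_C]
  norm_num
  simp only [map_ofNat]
  ring

/-- **The `[2]`-descent square identity.**  If `2` is a non-zero-divisor of `R`, `ΨSq₂(x₀) = 0` and
`4x₀² + b₂x₀ + b₄ = 2B`, then
`(Ỹ z)²·(u∘[2] − x₀[2]²) = ((u² − 2x₀z²u − Bz⁴)·[2])²`. [K-UNIV.md §2 (SQ-g)] -/
theorem sq_descent_two (h2 : ∀ a : R, 2 * a = 0 → a = 0) {x₀ B : R}
    (hx : 4 * x₀ ^ 3 + W.b₂ * x₀ ^ 2 + 2 * W.b₄ * x₀ + W.b₆ = 0)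
    (hB : 2 * B = 4 * x₀ ^ 2 + W.b₂ * x₀ + W.b₄) :
    (W.formalYTilde * X) ^ 2 * (W.formalXMulSq.subst (W.formalMul 2) - C x₀ * W.formalMul 2 ^ 2) =
      ((W.formalXMulSq ^ 2 - 2 * C x₀ * X ^ 2 * W.formalXMulSq - C B * X ^ 4) * W.formalMul 2) ^ 2 := by
  have hstar := W.sum_ΨSq_mul_formalXMulSq_subst_formalMul 2
  simp only [Nat.cast_ofNat] at hstar
  rw [sum_ΨSq_two_eq, sum_Φ_two_eq] at hstar
  have hx' : 4 * C x₀ ^ 3 + C W.b₂ * C x₀ ^ 2 + 2 * C W.b₄ * C x₀ + C W.b₆ = (0 : R⟦X⟧) := by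
    have := congrArg (C (R := R)) hx
    simpa only [map_add, map_mul, map_pow, map_ofNat, map_zero] using this
  have hB' : 2 * C B = 4 * C x₀ ^ 2 + C W.b₂ * C x₀ + C W.b₄ := by
    have := congrArg (C (R := R)) hB
    simpa only [map_add, map_mul, map_pow, map_ofNat] using this
  have hb' : 4 * C W.b₈ = C W.b₂ * C W.b₆ - C W.b₄ ^ 2 := by
    have := congrArg (C (R := R)) W.b_relation
    simpa only [map_sub, map_mul, map_pow, map_ofNat] using this
  have hid := four_mul_Φ_two_sub_identity W.formalXMulSq (X : R⟦X⟧) (C x₀) (C W.b₂) (C W.b₄) (C W.b₆)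
    (C W.b₈) hb'
  have hY := W.formalYTilde_sq_eq
  apply eq_of_four_mul_eq h2
  set u := W.formalXMulSq
  set h := W.formalMul 2
  set Y := W.formalYTilde
  set v := u.subst h
  linear_combination 4 * hstar - (4 * C x₀ * X ^ 2 * h ^ 2) * hY + h ^ 2 * hid
    - (h ^ 2 * (8 * u + 4 * C x₀ * X ^ 2 + C W.b₂ * X ^ 2) * X ^ 6) * hx'
    + (h ^ 2 * X ^ 4 * (4 * (u ^ 2 - 2 * C x₀ * X ^ 2 * u)
        - (4 * C x₀ ^ 2 + C W.b₂ * C x₀ + C W.b₄ + 2 * C B) * X ^ 4)) * hB'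

/-- The same identity with the substituted series written as `(u − x₀z²)∘[2]`, the form consumed by
`kummerClass_transfer` (`cg = Ỹ z`, `g = u − x₀z²`, `h = [2]`). [K-UNIV.md §2 (SQ-g)] -/
theorem sq_descent_two' (h2 : ∀ a : R, 2 * a = 0 → a = 0) {x₀ B : R}
    (hx : 4 * x₀ ^ 3 + W.b₂ * x₀ ^ 2 + 2 * W.b₄ * x₀ + W.b₆ = 0)
    (hB : 2 * B = 4 * x₀ ^ 2 + W.b₂ * x₀ + W.b₄) :
    (W.formalYTilde * X) ^ 2 * (W.formalXMulSq - C x₀ * X ^ 2).subst (W.formalMul 2) =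
      ((W.formalXMulSq ^ 2 - 2 * C x₀ * X ^ 2 * W.formalXMulSq - C B * X ^ 4) * W.formalMul 2) ^ 2 := by
  have hs : HasSubst (W.formalMul 2) := HasSubst.of_constantCoeff_zero' (W.constantCoeff_formalMul 2)
  rw [← sq_descent_two W h2 hx hB, ← coe_substAlgHom hs, map_sub, map_mul, map_pow, coe_substAlgHom hs,
    subst_X hs, subst_C]
  rfl

/-! ### (RHO-g): modulo `2`, `Ỹ = z·g`, `π(Ỹz) ≠ 0` and `g′ = ω·g` for `g = u − x₀z²` -/

section Rho

variable {k : Type*} [CommRing k] [CharP k 2] (π : R →+* k)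


/-- `d/dX` commutes with `map`. [folklore] -/
theorem derivative_map'' {S : Type*} [CommRing S] (φ : R →+* S) (f : R⟦X⟧) :
    d⁄dX S (f.map φ) = (d⁄dX R f).map φ := by
  ext n
  simp [coeff_derivative, coeff_map]

/-- **`Ỹ ≡ z·(u − x₀z²) (mod 2)`** when `a₁ ≡ 1` and `x₀ ≡ a₃ (mod 2)` (`Ỹ = (a₁z − 2)u + a₃z³`). [K-UNIV.md §2.6] -/
theorem map_formalYTilde_eq (ha1 : π W.a₁ = 1) {x₀ : R} (hx0 : π x₀ = π W.a₃) :
    W.formalYTilde.map π = X * (W.formalXMulSq - C x₀ * X ^ 2).map π := by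
  simp only [W.formalYTilde_def, map_add, map_mul, map_sub, map_pow, map_C, map_X, map_ofNat, ha1, map_one,
    one_mul, hx0]
  linear_combination (-(W.formalXMulSq.map π) + C (π W.a₃) * X ^ 3) * (Summit.BirchSwinnertonDyer.BirchSwinnertonDyer.Theorems.DepletionAtTwo.KEta.Kernel.two_eq_zero (k := k))

/-- **`π(Ỹ·z) = z²·ḡ ≠ 0`** (`ḡ(0) = 1`). [K-UNIV.md §2.6] -/
theorem map_formalYTilde_mul_X_ne_zero [Nontrivial k] (ha1 : π W.a₁ = 1) {x₀ : R} (hx0 : π x₀ = π W.a₃) :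
    (W.formalYTilde * X).map π ≠ 0 := by
  intro h0
  rw [map_mul, map_X, map_formalYTilde_eq W π ha1 hx0, mul_assoc, ← mul_zero (X : k⟦X⟧)] at h0
  have h1 := X_mul_cancel h0
  rw [← zero_mul (X : k⟦X⟧)] at h1
  have h2 := congrArg constantCoeff (mul_X_cancel h1)
  simp at h2
  rw [← coeff_zero_eq_constantCoeff_apply, coeff_map, coeff_zero_eq_constantCoeff_apply,
    W.constantCoeff_formalXMulSq, map_one] at h2
  exact one_ne_zero h2

/-- **`ḡ′ = ω̄·ḡ`** for `g = u − x₀z²` modulo `2` (`ω = formalInvDiff`): from the tree's `Ỹ·ω = z·u′ − 2u`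
(`formalYTilde_mul_formalInvDiff`) and `Ỹ ≡ z·g`. [K-UNIV.md §2.6] -/
theorem derivative_map_g_eq (ha1 : π W.a₁ = 1) {x₀ : R} (hx0 : π x₀ = π W.a₃) :
    d⁄dX k ((W.formalXMulSq - C x₀ * X ^ 2).map π) =
      W.formalInvDiff.map π * (W.formalXMulSq - C x₀ * X ^ 2).map π := by
  -- `h : X * ḡ * ω̄ = X * ū′`
  have h : X * (W.formalXMulSq - C x₀ * X ^ 2).map π * W.formalInvDiff.map π =
      X * d⁄dX k (W.formalXMulSq.map π) := by
    have h0 := congrArg (PowerSeries.map π) W.formalYTilde_mul_formalInvDiff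
    rw [map_mul, map_formalYTilde_eq W π ha1 hx0] at h0
    rw [h0]
    simp only [map_sub, map_mul, map_X, map_ofNat, ← derivative_map'', Summit.BirchSwinnertonDyer.BirchSwinnertonDyer.Theorems.DepletionAtTwo.KEta.Kernel.two_eq_zero, zero_mul, sub_zero]
  -- in characteristic `2`, `(x₀ z²)′ = 0`
  have hC : d⁄dX k ((C x₀ * X ^ 2 : R⟦X⟧).map π) = 0 := by
    ext n
    simp only [map_mul, map_pow, map_C, map_X, coeff_derivative, coeff_C_mul, coeff_X_pow, map_zero]
    split_ifs with hn
    · obtain rfl : n = 1 := by omega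
      have h2 : (2 : k) = 0 := by simpa using CharP.cast_eq_zero k 2
      rw [mul_one, Nat.cast_one, one_add_one_eq_two, h2, mul_zero]
    · rw [mul_zero, zero_mul]
  have hg' : d⁄dX k ((W.formalXMulSq - C x₀ * X ^ 2).map π) = d⁄dX k (W.formalXMulSq.map π) := by
    rw [map_sub, map_sub, hC, sub_zero]
  rw [hg']
  apply X_mul_cancel
  rw [← h]
  ring

end Rho

end Summit.BirchSwinnertonDyer.BirchSwinnertonDyer.Theorems.DepletionAtTwo.KEta.SqDescent




open PowerSeries Literature.NumberTheory.EllipticCurves Literature.RingTheory.FormalGroups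

namespace Summit.BirchSwinnertonDyer.BirchSwinnertonDyer.Theorems.DepletionAtTwo.KEta.ExpSide

section Rat

variable {A : Type*} [CommRing A] [Algebra ℚ A] [IsDomain A] (V : WeierstrassCurve A) (c : A)

/-- `F_c := exp(c · log_V)`. [K-UNIV.md §2.7] -/
def expLog : A⟦X⟧ := (exp A).subst (C c * V.formalLog)

/-- K-UNIV kernel lemma (THEOREM K formalisation, p2 GEN 37); see the file docstring. [folklore] -/
theorem constantCoeff_C_mul_formalLog : constantCoeff (C c * V.formalLog) = 0 := by
  rw [map_mul, V.constantCoeff_formalLog, mul_zero]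

/-- `F_c(0) = 1`. [folklore] -/
theorem constantCoeff_expLog : constantCoeff (expLog V c) = 1 :=
  constantCoeff_exp_subst (constantCoeff_C_mul_formalLog V c)

/-- `(C c · f)(a) = C c · f(a)`. [folklore] -/
theorem subst_C_mul'' {a : A⟦X⟧} (ha : HasSubst a) (f : A⟦X⟧) :
    (C c * f).subst a = C c * f.subst a := by
  rw [← smul_eq_C_mul, subst_smul ha, smul_eq_C_mul]

/-- **(SQ-F)** `F_c ∘ [n] = F_c ^ n` (`log ∘ [n] = n log`, `exp(n f) = exp(f)ⁿ`). [K-UNIV.md §2.7] -/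
theorem expLog_subst_formalMul (n : ℕ) :
    (expLog V c).subst (V.formalMul n) = (expLog V c) ^ n := by
  unfold expLog
  rw [exp_subst_subst (constantCoeff_C_mul_formalLog V c) (V.constantCoeff_formalMul n),
    subst_C_mul'' c (HasSubst.of_constantCoeff_zero' (V.constantCoeff_formalMul n)),
    V.formalLog_subst_formalMul_rat n, mul_smul_comm,
    exp_subst_nsmul (constantCoeff_C_mul_formalLog V c)]

/-- **(RHO-F)** `F_c′ = c·ω·F_c` with `ω = formalInvDiff (= formalOmega)`. [K-UNIV.md §2.7] -/
theorem derivative_expLog :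
    d⁄dX A (expLog V c) = C c * V.formalInvDiff * expLog V c := by
  unfold expLog
  rw [derivative_exp_subst (constantCoeff_C_mul_formalLog V c), Derivation.leibniz, derivative_C,
    smul_zero, add_zero, smul_eq_mul, V.derivative_formalLog, V.formalInvDiff_eq_formalOmega]
  ring

end Rat

/-! ### Descent to an integral structure along an injective ring map -/

section Descent

variable {O A : Type*} [CommRing O] [CommRing A] [Algebra ℚ A] [IsDomain A]
  (φ : O →+* A) (hφ : Function.Injective φ) (W : WeierstrassCurve O) {c₀ : O} {F₀ : O⟦X⟧}
  (hF : F₀.map φ = expLog (W.map φ) (φ c₀))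
include hφ hF

/-- `F₀ ∘ [n]_W = F₀ ^ n` in `O⟦X⟧`. [K-UNIV.md §2.7] -/
theorem subst_formalMul_eq_pow_of_map (n : ℕ) : F₀.subst (W.formalMul n) = F₀ ^ n := by
  apply map_injective φ hφ
  rw [map_subst_apply (HasSubst.of_constantCoeff_zero' (W.constantCoeff_formalMul n)), hF,
    W.map_formalMul φ n, expLog_subst_formalMul, map_pow, hF]

/-- `F₀′ = c₀·ω_W·F₀` in `O⟦X⟧`. [K-UNIV.md §2.7] -/
theorem derivative_eq_of_map : d⁄dX O F₀ = C c₀ * W.formalInvDiff * F₀ := by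
  apply map_injective φ hφ
  have hd : PowerSeries.map φ (d⁄dX O F₀) = d⁄dX A (F₀.map φ) := by
    ext n; simp [coeff_derivative, coeff_map]
  rw [hd, hF, derivative_expLog, map_mul, map_mul, map_C, W.map_formalInvDiff φ, hF]

/-- `F₀(0) = 1`. [folklore] -/
theorem constantCoeff_eq_one_of_map : constantCoeff F₀ = 1 := by
  apply hφ
  rw [← coeff_zero_eq_constantCoeff_apply, ← coeff_map, hF, coeff_zero_eq_constantCoeff_apply,
    constantCoeff_expLog, map_one]

end Descent

/-! ### Reduction: with `π c₀ = 1`, `F̄′ = ω̄ F̄`, so `ḡ′F̄ = F̄′ḡ` whenever `ḡ′ = ω̄ḡ` -/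

section Reduction

variable {O k : Type*} [CommRing O] [CommRing k] (π : O →+* k) (W : WeierstrassCurve O)

/-- If `F′ = c₀ ω F` and `π c₀ = 1` then `F̄′ = ω̄ F̄`. [K-UNIV.md §2.7] -/
theorem derivative_map_eq_of_derivative_eq {c₀ : O} {F₀ : O⟦X⟧}
    (hF : d⁄dX O F₀ = C c₀ * W.formalInvDiff * F₀) (hc : π c₀ = 1) :
    d⁄dX k (F₀.map π) = W.formalInvDiff.map π * F₀.map π := by
  have hd : d⁄dX k (F₀.map π) = PowerSeries.map π (d⁄dX O F₀) := by
    ext n; simp [coeff_derivative, coeff_map]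
  rw [hd, hF, map_mul, map_mul, map_C, hc, map_one, one_mul]

/-- The `hlog` hypothesis of `kummerClass_transfer`: equal logarithmic derivatives modulo `π`.
[K-UNIV.md §2.7] -/
theorem hlog_of_derivative_eq {g F ω : k⟦X⟧} (hg : d⁄dX k g = ω * g) (hF : d⁄dX k F = ω * F) :
    d⁄dX k g * F = d⁄dX k F * g := by
  rw [hg, hF]; ring

end Reduction

end Summit.BirchSwinnertonDyer.BirchSwinnertonDyer.Theorems.DepletionAtTwo.KEta.ExpSide

end
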